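import Summits.Schanuel.Schanuel.Theses.RoyCriterion

/-!
# `RoySmallValueDirichletGap` without `η ≠ 0` is false (negative lemma for crux `stmt-Schanuel-1050`)

Load-bearing analysis of the crux `Summit.Schanuel.Schanuel.Theses.RoyCriterion.RoySmallValueDirichletGap`
(Roy 2013, Mathematika 59 = arXiv:1301.0663, Theorem 1.1 pushed to the Dirichlet edge): the side
condition `η ≠ 0` cannot be dropped. On the `𝒟₁`-invariant line `X₂ = 0` every iterate
`𝒟₁ⁱ X₂ = X₂` vanishes, so `P_D = X₂` satisfies the small-value hypothesis at every point `(ξ, 0)`,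
in particular at the transcendental point `(e, 0)`. Everything is proved; no named facts.
-/

noncomputable section

namespace Summit.Schanuel.Schanuel.Theorems

open MvPolynomial Filter Complex
open Literature.NumberTheory.Transcendental

/-- **`η ≠ 0` is load-bearing in `RoySmallValueDirichletGap`**: the crux with the hypothesis
`η ≠ 0` deleted (verbatim otherwise) is FALSE — witness `(e, 0)`, `P_D = X₂`,
`(β, τ, ν) = (2, 1, 4)`. [cite: Roy2013, Theorem 1.1 (the hypothesis (ξ,η) ∈ ℂ × ℂˣ)] -/
theorem roySmallValueDirichletGap_false_without_etaNeZero :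
    ¬ (∀ (ξ η : ℂ), ∀ (β τ ν : ℝ), 1 ≤ τ → τ < 2 → τ < β → 2 + β - τ < ν →
      (∀ᶠ D : ℕ in Filter.atTop, ∃ P : MvPolynomial (Fin 2) ℤ, P ≠ 0 ∧ P.totalDegree ≤ D ∧
        (mvPolyHeight P : ℝ) ≤ Real.exp ((D : ℝ) ^ β) ∧
        ∀ i : ℕ, i < 3 * ⌊(D : ℝ) ^ τ⌋₊ →
          ‖MvPolynomial.aeval ![ξ, η] (royD^[i] P)‖ ≤ Real.exp (-(D : ℝ) ^ ν)) →
      IsAlgebraic ℚ ξ ∧ IsAlgebraic ℚ η) := by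
  intro h
  have hX : ∀ i : ℕ, royD^[i] (X 1 : MvPolynomial (Fin 2) ℤ) = X 1 :=
    fun i => Function.iterate_fixed royD_X_one i
  have hht : mvPolyHeight (X 1 : MvPolynomial (Fin 2) ℤ) ≤ 1 := by
    refine Finset.sup_le fun m _ => ?_
    rw [coeff_X]
    split_ifs <;> simp
  have hyp : ∀ᶠ D : ℕ in Filter.atTop, ∃ P : MvPolynomial (Fin 2) ℤ, P ≠ 0 ∧ P.totalDegree ≤ D ∧
      (mvPolyHeight P : ℝ) ≤ Real.exp ((D : ℝ) ^ (2 : ℝ)) ∧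
      ∀ i : ℕ, i < 3 * ⌊(D : ℝ) ^ (1 : ℝ)⌋₊ →
        ‖MvPolynomial.aeval ![cexp 1, (0 : ℂ)] (royD^[i] P)‖ ≤ Real.exp (-(D : ℝ) ^ (4 : ℝ)) := by
    filter_upwards [eventually_ge_atTop 1] with D hD
    refine ⟨X 1, X_ne_zero _, by simpa [totalDegree_X] using hD, ?_, fun i _ => ?_⟩
    · calc ((mvPolyHeight (X 1 : MvPolynomial (Fin 2) ℤ) : ℕ) : ℝ) ≤ 1 := by exact_mod_cast hht
        _ ≤ Real.exp ((D : ℝ) ^ (2 : ℝ)) := Real.one_le_exp (Real.rpow_nonneg (Nat.cast_nonneg D) _)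
    · rw [hX i]
      simp [(Real.exp_pos _).le]
  exact transcendental_exp_holds isAlgebraic_one one_ne_zero
    (h (cexp 1) 0 2 1 4 le_rfl (by norm_num) (by norm_num) (by norm_num) hyp).1

end Summit.Schanuel.Schanuel.Theorems

end
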